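import Mathlib

/-!
# The inflated MOR returns `U₄ₖ ⊂ M_{4k}(ℂ)` — the witness that kills LINE β's laws `HalfSpeedIrrLaw` / `HalfSpeedLaw`
# (Negative lane of crux `DualUnipotentThreeHalves`, supports stmt-ValiantsHypothesis-24318; part 1 of 2 — the space)

val-idea-crit-7 g2 (critic of record, director-valiant b124 WAVE-2; kernel leg of VERDICT #13 under RULING R295 (a)/(b));
WITNESS, killing word and paper proof by val-idea-30 g2 (`Cruxes/DualUnipotentThreeHalves/InflatedReturns.lean`, `HALFSPEED-DEAD.md`);
part 2 = `Negative/HalfSpeedIrrLawFalse.lean` (the word argument and `¬ HalfSpeedIrrLaw`, `¬ HalfSpeedLaw`).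

On `ι = Fin 4 × Fin k`: `U₄ₖ := { J₄ ⊗ A + s·(R₂ ⊗ 1_k) : A ∈ M_k(ℂ), s ∈ ℂ }`, `J₄ = E₀₁+E₁₂+E₂₃`, `R₂ = E₂₀ − E₃₁`
(Mathes–Omladič–Radjavi 1991 §5: `span{J₄, R₂}` is an irreducible nilpotent plane of `M₄`, `(xJ₄+yR₂)⁴ = 0`).  This file proves:
`U₄ₖ` is a NILPOTENT space (`infl_pow_four`: `X⁴ = 0` — the second tensor factors `A, 1` commute, so the polarised identities
`J₄⁴ = 0`, `J₄²(J₄R₂+R₂J₄) + (J₄R₂+R₂J₄)J₄² = 0`, `(J₄R₂+R₂J₄)² = 0`, `R₂² = 0` suffice); `U₄ₖ` is IRREDUCIBLE on `ℂ⁴ ⊗ ℂᵏ`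
(`inflSpace_irreducible`, every `k`); `dim U₄ₖ = k² + 1` (`finrank_inflSpace`, `k ≥ 1`).
Honest framing: these are plain linear-algebra facts about one explicit family; nothing here touches R2 `HeavyTopLaw`, line α or
24318/8062, and `VP ≠ VNP` is NOT proved.  No definitions of record, no named facts (the `def`s are the witness's own data).
-/

set_option linter.dupNamespace false
set_option autoImplicit false

open Matrix
open scoped Kronecker BigOperators

namespace Summit.ValiantsHypothesis.ValiantsHypothesis.Theorems.DualUnipotentThreeHalvesNegative.InflatedReturns

/-! ## §1 The 4 × 4 letters and their identities -/

/-- `J₄ = E₀₁ + E₁₂ + E₂₃`. -/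
def J4 : Matrix (Fin 4) (Fin 4) ℂ := !![0, 1, 0, 0; 0, 0, 1, 0; 0, 0, 0, 1; 0, 0, 0, 0]
/-- `R₂ = E₂₀ − E₃₁`. -/
def R2 : Matrix (Fin 4) (Fin 4) ℂ := !![0, 0, 0, 0; 0, 0, 0, 0; 1, 0, 0, 0; 0, -1, 0, 0]
/-- `D = J₄²R₂ = E₀₀ − E₁₁`. -/
def D : Matrix (Fin 4) (Fin 4) ℂ := !![1, 0, 0, 0; 0, -1, 0, 0; 0, 0, 0, 0; 0, 0, 0, 0]
/-- `E₃₀`. -/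
def E30 : Matrix (Fin 4) (Fin 4) ℂ := !![0, 0, 0, 0; 0, 0, 0, 0; 0, 0, 0, 0; 1, 0, 0, 0]

/-- `R₂² = 0`. -/
lemma R2_mul_R2 : R2 * R2 = 0 := by
  ext i j; fin_cases i <;> fin_cases j <;> simp [R2, Matrix.mul_apply, Fin.sum_univ_four]

/-- `J₄²R₂ = E₀₀ − E₁₁`. -/
lemma J4_sq_mul_R2 : J4 * J4 * R2 = D := by
  ext i j; fin_cases i <;> fin_cases j <;> simp [J4, R2, D, Matrix.mul_apply, Fin.sum_univ_four]

/-- `(J₄R₂ + R₂J₄)R₂ = −E₃₀`. -/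
lemma cross_mul_R2 : (J4 * R2 + R2 * J4) * R2 = (-1 : ℂ) • E30 := by
  ext i j; fin_cases i <;> fin_cases j <;> simp [J4, R2, E30, Matrix.mul_apply, Fin.sum_univ_four]

/-- `(J₄R₂ + R₂J₄)R₂ = −E₃₀`, distributed form. -/
lemma cross_mul_R2' : J4 * R2 * R2 + R2 * J4 * R2 = (-1 : ℂ) • E30 := by
  ext i j; fin_cases i <;> fin_cases j <;> simp [J4, R2, E30, Matrix.add_apply]

/-- `J₄⁴ = 0`. -/
lemma J4_sq_sq : J4 * J4 * (J4 * J4) = 0 := by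
  ext i j; fin_cases i <;> fin_cases j <;> simp [J4, Matrix.mul_apply, Fin.sum_univ_four]

/-- The degree-`(3,1)` polarisation identity `J₄²(J₄R₂+R₂J₄) + (J₄R₂+R₂J₄)J₄² = 0`. -/
lemma c3_zero : J4 * J4 * (J4 * R2 + R2 * J4) + (J4 * R2 + R2 * J4) * (J4 * J4) = 0 := by
  ext i j; fin_cases i <;> fin_cases j <;> simp [J4, R2, Matrix.add_apply]

/-- `(J₄R₂ + R₂J₄)² = 0` (with `R₂² = 0`, the degree-`(2,2)` polarisation identity). -/
lemma c2_zero : (J4 * R2 + R2 * J4) * (J4 * R2 + R2 * J4) = 0 := by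
  ext i j; fin_cases i <;> fin_cases j <;> simp [J4, R2, Matrix.mul_apply, Fin.sum_univ_four]

/-! ## §2 The inflation on `ι = Fin 4 × Fin k` -/

variable (k : ℕ)

/-- The index type `Fin 4 × Fin k` of `ℂ⁴ ⊗ ℂᵏ`. -/
abbrev ι : Type := Fin 4 × Fin k

/-- `infl k A s = J₄ ⊗ A + s·(R₂ ⊗ 1)`. -/
def infl (A : Matrix (Fin k) (Fin k) ℂ) (s : ℂ) : Matrix (ι k) (ι k) ℂ :=
  J4 ⊗ₖ A + s • (R2 ⊗ₖ (1 : Matrix (Fin k) (Fin k) ℂ))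

/-- The inflation as a linear map `M_k × ℂ → M_{4k}`. -/
def inflLin : (Matrix (Fin k) (Fin k) ℂ × ℂ) →ₗ[ℂ] Matrix (ι k) (ι k) ℂ where
  toFun p := infl k p.1 p.2
  map_add' p q := by
    simp only [infl, Prod.fst_add, Prod.snd_add, Matrix.kronecker_add, add_smul]; abel
  map_smul' c p := by
    simp only [infl, Prod.smul_fst, Prod.smul_snd, Matrix.kronecker_smul, smul_eq_mul, RingHom.id_apply, smul_add,
      mul_smul]

/-- `U₄ₖ` as a submodule of `M_{4k}(ℂ)`. -/
def inflSpace : Submodule ℂ (Matrix (ι k) (ι k) ℂ) := LinearMap.range (inflLin k)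

/-- Membership in `U₄ₖ`. -/
lemma mem_inflSpace {X : Matrix (ι k) (ι k) ℂ} : X ∈ inflSpace k ↔ ∃ A s, X = infl k A s := by
  constructor
  · rintro ⟨p, rfl⟩; exact ⟨p.1, p.2, rfl⟩
  · rintro ⟨A, s, rfl⟩; exact ⟨(A, s), rfl⟩

/-- Inflated matrices lie in `U₄ₖ`. -/
lemma infl_mem (A : Matrix (Fin k) (Fin k) ℂ) (s : ℂ) : infl k A s ∈ inflSpace k :=
  (mem_inflSpace k).2 ⟨A, s, rfl⟩

/-- The square of an inflated matrix. -/
lemma infl_sq (A : Matrix (Fin k) (Fin k) ℂ) (s : ℂ) :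
    infl k A s * infl k A s = (J4 * J4) ⊗ₖ (A * A) + s • ((J4 * R2 + R2 * J4) ⊗ₖ A) := by
  simp only [infl, add_mul, mul_add, smul_mul_assoc, mul_smul_comm, ← Matrix.mul_kronecker_mul, Matrix.mul_one,
    Matrix.one_mul, R2_mul_R2, Matrix.zero_kronecker, smul_zero, add_zero, Matrix.add_kronecker, smul_add]
  abel

/-- **`U₄ₖ` is a nilpotent space**: `X⁴ = 0`. -/
theorem infl_pow_four (A : Matrix (Fin k) (Fin k) ℂ) (s : ℂ) : infl k A s ^ 4 = 0 := by
  have h4 : infl k A s ^ 4 = (infl k A s * infl k A s) * (infl k A s * infl k A s) := by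
    rw [← pow_two, ← pow_two, ← pow_mul]
  rw [h4, infl_sq]
  set C := J4 * R2 + R2 * J4 with hC
  have hCC : C * C = 0 := by rw [hC]; exact c2_zero
  have hc3 : C * (J4 * J4) + J4 * J4 * C = 0 := by rw [add_comm, hC]; exact c3_zero
  have hA : A * A * A = A * (A * A) := Matrix.mul_assoc _ _ _
  simp only [add_mul, mul_add, smul_mul_assoc, mul_smul_comm, ← Matrix.mul_kronecker_mul, J4_sq_sq,
    Matrix.zero_kronecker, zero_add, hCC, smul_zero, add_zero, hA]
  simp only [← smul_add, ← Matrix.add_kronecker, hc3, Matrix.zero_kronecker, smul_zero]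

/-- **`U₄ₖ` is a nilpotent space.** -/
theorem inflSpace_nilpotent : ∀ X ∈ inflSpace k, IsNilpotent X := by
  intro X hX
  obtain ⟨A, s, rfl⟩ := (mem_inflSpace k).1 hX
  exact ⟨4, infl_pow_four k A s⟩

/-! ## §3 Block vectors and the action of the letters -/

/-- `bv a x = e_a ⊗ x`. -/
def bv (a : Fin 4) (x : Fin k → ℂ) : ι k → ℂ := fun p => if p.1 = a then x p.2 else 0

/-- `e_a ⊗ 0 = 0`. -/
@[simp] lemma bv_zero (a : Fin 4) : bv k a 0 = 0 := by
  ext p; simp [bv]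

/-- Action of a Kronecker product on a block vector. -/
lemma kron_mulVec_bv (M : Matrix (Fin 4) (Fin 4) ℂ) (N : Matrix (Fin k) (Fin k) ℂ) (a : Fin 4) (x : Fin k → ℂ) :
    (M ⊗ₖ N) *ᵥ bv k a x = fun p => M p.1 a * (N *ᵥ x) p.2 := by
  ext ⟨b, i⟩
  simp only [Matrix.mulVec, dotProduct, bv, Matrix.kroneckerMap_apply, Fintype.sum_prod_type, mul_ite, mul_zero]
  rw [Finset.sum_eq_single a]
  · simp only [if_true, Finset.mul_sum, mul_assoc]
  · intro c _ hc; simp [hc]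
  · intro h; exact absurd (Finset.mem_univ a) h

/-- `(J₄ ⊗ A)(e_a ⊗ x) = e_{a-1} ⊗ Ax` (`= 0` for `a = 0`). -/
lemma JA_bv (A : Matrix (Fin k) (Fin k) ℂ) (a : Fin 4) (x : Fin k → ℂ) :
    (J4 ⊗ₖ A) *ᵥ bv k a x =
      if a = 0 then 0 else bv k (a - 1) (A *ᵥ x) := by
  rw [kron_mulVec_bv]
  ext ⟨b, i⟩
  fin_cases a <;> fin_cases b <;> simp [J4, bv]

/-- `(R₂ ⊗ 1)(e_0 ⊗ x) = e_2 ⊗ x`, `(R₂ ⊗ 1)(e_1 ⊗ x) = −e_3 ⊗ x`, else `0`. -/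
lemma R1_bv (a : Fin 4) (x : Fin k → ℂ) :
    (R2 ⊗ₖ (1 : Matrix (Fin k) (Fin k) ℂ)) *ᵥ bv k a x =
      if a = 0 then bv k 2 x else if a = 1 then -bv k 3 x else 0 := by
  rw [kron_mulVec_bv]
  ext ⟨b, i⟩
  fin_cases a <;> fin_cases b <;> simp [R2, bv]

/-- `J₄ ⊗ A ∈ U₄ₖ`. -/
lemma JA_mem : ∀ A : Matrix (Fin k) (Fin k) ℂ, J4 ⊗ₖ A ∈ inflSpace k := by
  intro A
  have : infl k A 0 = J4 ⊗ₖ A := by simp [infl]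
  rw [← this]; exact infl_mem k A 0

/-- `R₂ ⊗ 1 ∈ U₄ₖ`. -/
lemma R1_mem : R2 ⊗ₖ (1 : Matrix (Fin k) (Fin k) ℂ) ∈ inflSpace k := by
  have : infl k 0 1 = R2 ⊗ₖ (1 : Matrix (Fin k) (Fin k) ℂ) := by simp [infl]
  rw [← this]; exact infl_mem k 0 1

/-- Every vector is the sum of its four blocks. -/
lemma eq_sum_bv (v : ι k → ℂ) :
    v = bv k 0 (fun i => v (0, i)) + bv k 1 (fun i => v (1, i)) + bv k 2 (fun i => v (2, i)) +
      bv k 3 (fun i => v (3, i)) := by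
  ext ⟨b, i⟩
  fin_cases b <;> simp [bv]

/-- **`U₄ₖ` is irreducible** on `ℂ⁴ ⊗ ℂᵏ` (`k ≥ 1`). -/
theorem inflSpace_irreducible :
    ∀ V : Submodule ℂ (ι k → ℂ), (∀ X ∈ inflSpace k, ∀ x ∈ V, X *ᵥ x ∈ V) → V = ⊥ ∨ V = ⊤ := by
  intro V hV
  by_cases hbot : V = ⊥
  · exact Or.inl hbot
  right
  -- a non-zero vector of `V`
  obtain ⟨v, hvV, hv0⟩ : ∃ v ∈ V, v ≠ 0 := by
    by_contra h
    push Not at h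
    exact hbot ((Submodule.eq_bot_iff V).2 h)
  -- actions
  have hJ1 : ∀ x ∈ V, (J4 ⊗ₖ (1 : Matrix (Fin k) (Fin k) ℂ)) *ᵥ x ∈ V := fun x hx => hV _ (JA_mem k 1) x hx
  have hJA : ∀ A, ∀ x ∈ V, (J4 ⊗ₖ A) *ᵥ x ∈ V := fun A x hx => hV _ (JA_mem k A) x hx
  have hR : ∀ x ∈ V, (R2 ⊗ₖ (1 : Matrix (Fin k) (Fin k) ℂ)) *ᵥ x ∈ V := fun x hx => hV _ (R1_mem k) x hx
  -- Step 1: some `bv 0 w ∈ V` with `w ≠ 0`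
  set y0 : Fin k → ℂ := fun i => v (0, i)
  set y1 : Fin k → ℂ := fun i => v (1, i)
  set y2 : Fin k → ℂ := fun i => v (2, i)
  set y3 : Fin k → ℂ := fun i => v (3, i)
  have hv : v = bv k 0 y0 + bv k 1 y1 + bv k 2 y2 + bv k 3 y3 := eq_sum_bv k v
  have hJv : (J4 ⊗ₖ (1 : Matrix (Fin k) (Fin k) ℂ)) *ᵥ v = bv k 0 y1 + bv k 1 y2 + bv k 2 y3 := by
    conv_lhs => rw [hv]
    simp [Matrix.mulVec_add, JA_bv]
  have hJJv : (J4 ⊗ₖ (1 : Matrix (Fin k) (Fin k) ℂ)) *ᵥ ((J4 ⊗ₖ (1 : Matrix (Fin k) (Fin k) ℂ)) *ᵥ v) =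
      bv k 0 y2 + bv k 1 y3 := by
    rw [hJv]; simp [Matrix.mulVec_add, JA_bv]
  have hJJJv : (J4 ⊗ₖ (1 : Matrix (Fin k) (Fin k) ℂ)) *ᵥ ((J4 ⊗ₖ (1 : Matrix (Fin k) (Fin k) ℂ)) *ᵥ
      ((J4 ⊗ₖ (1 : Matrix (Fin k) (Fin k) ℂ)) *ᵥ v)) = bv k 0 y3 := by
    rw [hJJv]; simp [Matrix.mulVec_add, JA_bv]
  have hbv_ne : ∀ (a : Fin 4) (x : Fin k → ℂ), x ≠ 0 → bv k a x ≠ 0 := by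
    intro a x hx h
    apply hx; ext i
    have := congrFun h (a, i)
    simpa [bv] using this
  obtain ⟨w, hw0, hwV⟩ : ∃ w : Fin k → ℂ, w ≠ 0 ∧ bv k 0 w ∈ V := by
    by_cases h3 : y3 ≠ 0
    · exact ⟨y3, h3, hJJJv ▸ hJ1 _ (hJ1 _ (hJ1 _ hvV))⟩
    push Not at h3
    by_cases h2 : y2 ≠ 0
    · refine ⟨y2, h2, ?_⟩
      have := hJ1 _ (hJ1 _ hvV); rw [hJJv, h3] at this; simpa [bv] using this
    push Not at h2
    by_cases h1 : y1 ≠ 0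
    · refine ⟨y1, h1, ?_⟩
      have := hJ1 _ hvV; rw [hJv, h2, h3] at this; simpa [bv] using this
    push Not at h1
    refine ⟨y0, ?_, ?_⟩
    · intro h0; apply hv0; rw [hv, h0, h1, h2, h3]; ext p; simp
    · rw [hv, h1, h2, h3] at hvV; simpa [bv] using hvV
  -- Step 2: `bv 0 (A w) ∈ V` for every `A`
  have hstep : ∀ A : Matrix (Fin k) (Fin k) ℂ, bv k 0 (A *ᵥ w) ∈ V := by
    intro A
    have h1 : bv k 2 w ∈ V := by simpa [R1_bv] using hR _ hwV
    have h2 : bv k 1 (A *ᵥ w) ∈ V := by simpa [JA_bv] using hJA A _ h1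
    simpa [JA_bv] using hJ1 _ h2
  -- Step 3: `bv 0 x ∈ V` for every `x`
  have h0 : ∀ x : Fin k → ℂ, bv k 0 x ∈ V := by
    intro x
    obtain ⟨j, hj⟩ : ∃ j, w j ≠ 0 := by
      by_contra h; push Not at h; exact hw0 (funext h)
    let A : Matrix (Fin k) (Fin k) ℂ := fun i l => if l = j then x i / w j else 0
    have hA : A *ᵥ w = x := by
      ext i
      simp only [Matrix.mulVec, dotProduct, A, ite_mul, zero_mul, Finset.sum_ite_eq', Finset.mem_univ, if_true]
      field_simp
    simpa [hA] using hstep A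
  -- Step 4: all blocks
  have h2 : ∀ x : Fin k → ℂ, bv k 2 x ∈ V := fun x => by simpa [R1_bv] using hR _ (h0 x)
  have h1 : ∀ x : Fin k → ℂ, bv k 1 x ∈ V := fun x => by simpa [JA_bv] using hJ1 _ (h2 x)
  have h3 : ∀ x : Fin k → ℂ, bv k 3 x ∈ V := fun x => by
    have := hR _ (h1 x)
    simp [R1_bv] at this
    simpa using V.neg_mem this
  -- conclusion
  rw [eq_top_iff]
  intro y _
  rw [eq_sum_bv k y]
  exact V.add_mem (V.add_mem (V.add_mem (h0 _) (h1 _)) (h2 _)) (h3 _)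


/-! ## §5 Dimension count -/

/-- The `M_k`-part (block `(0,1)`) as a linear map. -/
def blockPart : Matrix (ι k) (ι k) ℂ →ₗ[ℂ] Matrix (Fin k) (Fin k) ℂ where
  toFun X := Matrix.of fun i l => X (0, i) (1, l)
  map_add' X Y := by ext i l; simp
  map_smul' c X := by ext i l; simp

/-- The `s`-part (entry `((2,i₀),(0,i₀))`) as a linear map. -/
def scalarPart (i₀ : Fin k) : Matrix (ι k) (ι k) ℂ →ₗ[ℂ] ℂ where
  toFun X := X (2, i₀) (0, i₀)
  map_add' X Y := by simp
  map_smul' c X := by simp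

/-- The block part of `J₄ ⊗ A + s·(R₂ ⊗ 1)` is `A`. -/
lemma blockPart_infl (A : Matrix (Fin k) (Fin k) ℂ) (s : ℂ) : blockPart k (infl k A s) = A := by
  ext i l
  simp [blockPart, infl, Matrix.kroneckerMap_apply, J4, R2]

/-- The scalar part of `J₄ ⊗ A + s·(R₂ ⊗ 1)` is `s`. -/
lemma scalarPart_infl (i₀ : Fin k) (A : Matrix (Fin k) (Fin k) ℂ) (s : ℂ) : scalarPart k i₀ (infl k A s) = s := by
  simp [scalarPart, infl, Matrix.kroneckerMap_apply, J4, R2]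

/-- The inflation is injective (`k ≥ 1`). -/
lemma inflLin_injective (hk : 1 ≤ k) : Function.Injective (inflLin k) := by
  intro p q h
  have i₀ : Fin k := ⟨0, hk⟩
  have hA : p.1 = q.1 := by
    have := congrArg (blockPart k) h
    simpa [inflLin, blockPart_infl] using this
  have hs : p.2 = q.2 := by
    have := congrArg (scalarPart k i₀) h
    simpa [inflLin, scalarPart_infl] using this
  exact Prod.ext hA hs

/-- `dim U₄ₖ = k² + 1` (`k ≥ 1`). -/
lemma finrank_inflSpace (hk : 1 ≤ k) : Module.finrank ℂ (inflSpace k) = k * k + 1 := by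
  rw [inflSpace, LinearMap.finrank_range_of_inj (inflLin_injective k hk)]
  simp [Module.finrank_prod, Module.finrank_matrix]


end Summit.ValiantsHypothesis.ValiantsHypothesis.Theorems.DualUnipotentThreeHalvesNegative.InflatedReturns
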